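import Summits.FinalStateConjecture.FinalStateConjecture.Theorems.SwallowTheDatumParametricKerrBurialStubEndChartDatum
import Summits.FinalStateConjecture.FinalStateConjecture.Theorems.SwallowTheDatumKerrShieldedDataExistAssemblyGlue
import Literature.Geometry.Lorentzian.InitialDataLocality
import HarnessLib

/-!
# Crux `SwallowTheDatum.UniversalWitnessFamily` (stmt-FinalStateConjecture-10051), line `Sketch`,
# stub `stub_capEnd` — support part 1: initial data sets on `ℝ³` from pieces

Support file (everything proved, no definitions) for the stub `stub_capEnd` (capping the end through
the inversion chart) and for its neighbour `stub_plugDataPlusFrom_of`: the elementary PATCHING of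
initial data sets on `E3 = ℝ³`.

* `exists_initialDataSet_of_pieces` — two TOTAL coefficient fields `(h, k)` on `ℝ³` which near every
  point agree with the sections of SOME initial data set on an open subset of `ℝ³` (a "local model")
  are the coordinate readings `coordH`, `coordK` of an initial data set on `ℝ³` (smoothness,
  symmetry and positivity are read off the models; `exists_initialDataSet_of_contDiff`);
* `vacAt_of_model`, `vacAt_of_eqOn` — the vacuum constraints AT A POINT transfer from a local model
  (on an open subset, or on `ℝ³`) to the patched datum: the constraint map is local and natural under
  the inclusion of an open subset (`InitialDataSet.isVacuumAt_comap_iff`, `isVacuumAt_congr`;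
  Bartnik–Isenberg 2004, §2);
* `exists_patch_ball` — two data on `ℝ³` with the same sections on an annulus `{a < ‖y‖ < b}` patch
  to one datum, equal to the first inside radius `b` and to the second beyond radius `a`, vacuum at a
  point where the relevant piece is.

References: R. Bartnik, J. Isenberg, *The constraint equations* (2004), §2 (local character and
diffeomorphism equivariance of the constraint map); J. Corvino, Comm. Math. Phys. 214 (2000), §4
(patching data agreeing on overlaps).
-/

-- the doubled `FinalStateConjecture` path component is the summit/problem naming scheme, not a mistake
set_option linter.dupNamespace false

noncomputable section

namespace Summit.FinalStateConjecture.FinalStateConjecture.Theorems.SwallowTheDatum.UniversalWitnessFamily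

open scoped Manifold ContDiff Topology
open Set Filter Function TopologicalSpace Literature.Geometry.Lorentzian
open Literature.Geometry.Manifold (OpenSubmanifold.mfderiv_subtype_val)

/-! ### Restriction of a datum on `ℝ³` to an open subset: section formulas -/

/-- The metric of the restriction `D|_U = val^* D` of a datum on `ℝ³` to an open subset `U` at
`u` is `h_u` (the differential of the inclusion is the identity). [folklore] -/
theorem comap_subtypeVal_h_inner (D : InitialDataSet (𝓡 3) E3) (U : Opens E3) (u : U) (v w : E3) :
    (D.comap (Subtype.val : U → E3) (InitialDataSet.contMDiff_subtypeVal_succ U)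
      (InitialDataSet.injective_mfderiv_subtypeVal U)).h.inner u v w = D.h.inner (u : E3) v w := by
  rw [InitialDataSet.comap_h_inner, OpenSubmanifold.mfderiv_subtype_val]
  rfl

/-- The tensor `k` of the restriction of a datum on `ℝ³` to an open subset `U` at `u` is `k_u`.
[folklore] -/
theorem comap_subtypeVal_k (D : InitialDataSet (𝓡 3) E3) (U : Opens E3) (u : U) (v w : E3) :
    (D.comap (Subtype.val : U → E3) (InitialDataSet.contMDiff_subtypeVal_succ U)
      (InitialDataSet.injective_mfderiv_subtypeVal U)).k u v w = D.k (u : E3) v w := by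
  rw [InitialDataSet.comap_k, OpenSubmanifold.mfderiv_subtype_val]
  rfl

/-- **Registered anchor of this support file** (`capEnd_restrict_h_inner`, crux item
stmt-FinalStateConjecture-10051): the metric of the restriction of a datum on `ℝ³` to an open subset,
`comap_subtypeVal_h_inner`. [folklore] -/
theorem capEnd_restrict_h_inner :
    ∀ (D : InitialDataSet (𝓡 3) E3) (U : TopologicalSpace.Opens E3) (u : U) (v w : E3),
      (D.comap (Subtype.val : U → E3) (InitialDataSet.contMDiff_subtypeVal_succ U)
        (InitialDataSet.injective_mfderiv_subtypeVal U)).h.inner u v w = D.h.inner (u : E3) v w :=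
  comap_subtypeVal_h_inner

/-! ### Data on `ℝ³` from local models -/

section Pieces

variable {hF kF : E3 → E3 →L[ℝ] E3 →L[ℝ] ℝ}

/-- **An initial data set on `ℝ³` from pieces.** Let `(h, k)` be total fields of bilinear forms on
`ℝ³` such that every point `y` has an open neighbourhood `W`, contained in an open subset `U`, and an
initial data set `D_U` on `U` whose sections agree with `(h, k)` on `W`. Then `(h, k)` are the
coordinate readings of an initial data set on `ℝ³` (smoothness, symmetry and positive definiteness
are local and hold for the models). Corvino 2000, §4; Bartnik–Isenberg 2004, §2.
[cite: BartnikIsenberg2004, §2] -/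
theorem exists_initialDataSet_of_pieces
    (hloc : ∀ y : E3, ∃ (U : Opens E3) (DU : InitialDataSet 𝓘(ℝ, E3) U) (W : Set E3),
      IsOpen W ∧ y ∈ W ∧ W ⊆ U ∧
      ∀ z (hz : z ∈ U), z ∈ W →
        (∀ v w, hF z v w = DU.h.inner ⟨z, hz⟩ v w) ∧ (∀ v w, kF z v w = DU.k ⟨z, hz⟩ v w)) :
    ∃ D : InitialDataSet (𝓡 3) E3, D.coordH = hF ∧ D.coordK = kF := by
  have hsymm : ∀ y v w, hF y v w = hF y w v := fun y v w ↦ by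
    obtain ⟨U, DU, W, -, hyW, hWU, hag⟩ := hloc y
    rw [(hag y (hWU hyW) hyW).1 v w, (hag y (hWU hyW) hyW).1 w v]
    exact DU.h.symm _ v w
  have hpos : ∀ y v, v ≠ 0 → 0 < hF y v v := fun y v hv ↦ by
    obtain ⟨U, DU, W, -, hyW, hWU, hag⟩ := hloc y
    rw [(hag y (hWU hyW) hyW).1 v v]
    exact DU.h.pos _ v hv
  have hksymm : ∀ y v w, kF y v w = kF y w v := fun y v w ↦ by
    obtain ⟨U, DU, W, -, hyW, hWU, hag⟩ := hloc y
    rw [(hag y (hWU hyW) hyW).2 v w, (hag y (hWU hyW) hyW).2 w v]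
    exact DU.k_symm _ v w
  have hhs : ∀ y, ContDiffAt ℝ ∞ hF y := fun y ↦ by
    obtain ⟨U, DU, W, hWo, hyW, hWU, hag⟩ := hloc y
    exact Assembly.contDiffAt_of_localData_h DU hWo hyW hWU fun z hz hzW ↦ (hag z hz hzW).1
  have hks : ∀ y, ContDiffAt ℝ ∞ kF y := fun y ↦ by
    obtain ⟨U, DU, W, hWo, hyW, hWU, hag⟩ := hloc y
    exact Assembly.contDiffAt_of_localData_k DU hWo hyW hWU fun z hz hzW ↦ (hag z hz hzW).2
  exact ParametricKerrBurial.exists_initialDataSet_of_contDiff hF kF (contDiff_iff_contDiffAt.2 hhs)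
    (contDiff_iff_contDiffAt.2 hks) hsymm hpos hksymm

end Pieces

/-! ### Transfer of the vacuum constraints at a point -/

/-- **The vacuum constraints at a point transfer from a local model on an open subset.** If the
sections of a datum `D` on `ℝ³` agree on an open neighbourhood `W ⊆ U` of `y` with those of a datum
`D_U` on the open subset `U`, and `D_U` satisfies the vacuum constraints at `y`, then so does `D`
(the restriction `D|_U` has the germ of `D_U` at `y`, `isVacuumAt_congr`, and the constraint map is
natural under the inclusion, `isVacuumAt_comap_iff`). Bartnik–Isenberg 2004, §2.
[cite: BartnikIsenberg2004, §2] -/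
theorem vacAt_of_model (D : InitialDataSet (𝓡 3) E3) {U : Opens E3} (DU : InitialDataSet 𝓘(ℝ, E3) U)
    {W : Set E3} (hWo : IsOpen W) (hWU : W ⊆ U) {y : E3} (hyW : y ∈ W)
    (hag : ∀ z (hz : z ∈ U), z ∈ W →
      (∀ v w, D.h.inner z v w = DU.h.inner ⟨z, hz⟩ v w) ∧ (∀ v w, D.k z v w = DU.k ⟨z, hz⟩ v w))
    (hvac : ∀ [DU.metric.HasLeviCivita],
      DU.hamiltonianConstraintFn ⟨y, hWU hyW⟩ = 0 ∧ DU.momentumConstraintFn ⟨y, hWU hyW⟩ = 0) :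
    ∀ [D.metric.HasLeviCivita], D.hamiltonianConstraintFn y = 0 ∧ D.momentumConstraintFn y = 0 := by
  intro _
  have hyU : y ∈ U := hWU hyW
  haveI hLU : DU.metric.HasLeviCivita := PseudoRiemannianMetric.hasLeviCivita _
  haveI hLc : (D.comap (Subtype.val : U → E3) (InitialDataSet.contMDiff_subtypeVal_succ U)
      (InitialDataSet.injective_mfderiv_subtypeVal U)).metric.HasLeviCivita :=
    PseudoRiemannianMetric.hasLeviCivita _
  have hev : ∀ᶠ u : U in 𝓝 (⟨y, hyU⟩ : U), (u : E3) ∈ W :=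
    continuous_subtype_val.continuousAt.preimage_mem_nhds (hWo.mem_nhds hyW)
  have hh : ∀ᶠ u : U in 𝓝 (⟨y, hyU⟩ : U),
      (D.comap (Subtype.val : U → E3) (InitialDataSet.contMDiff_subtypeVal_succ U)
        (InitialDataSet.injective_mfderiv_subtypeVal U)).h.inner u = DU.h.inner u := by
    filter_upwards [hev] with u hu
    ext v w
    rw [comap_subtypeVal_h_inner]
    exact (hag u u.2 hu).1 v w
  have hk : ∀ᶠ u : U in 𝓝 (⟨y, hyU⟩ : U),
      (D.comap (Subtype.val : U → E3) (InitialDataSet.contMDiff_subtypeVal_succ U)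
        (InitialDataSet.injective_mfderiv_subtypeVal U)).k u = DU.k u := by
    filter_upwards [hev] with u hu
    ext v w
    rw [comap_subtypeVal_k]
    exact (hag u u.2 hu).2 v w
  have h1 := InitialDataSet.isVacuumAt_comap_iff D (InitialDataSet.contMDiff_subtypeVal_succ U)
    (InitialDataSet.injective_mfderiv_subtypeVal U) (⟨y, hyU⟩ : U)
  have h2 := InitialDataSet.isVacuumAt_congr (x := (⟨y, hyU⟩ : U)) hh hk
  exact h1.1 (h2.2 hvac)

/-- **The vacuum constraints at a point transfer between data on `ℝ³` with the same sections near the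
point** (`isVacuumAt_congr`, with the Levi-Civita instances supplied). Bartnik–Isenberg 2004, §2.
[cite: BartnikIsenberg2004, §2] -/
theorem vacAt_of_eqOn (D D' : InitialDataSet (𝓡 3) E3) {W : Set E3} (hWo : IsOpen W) {y : E3}
    (hyW : y ∈ W) (hh : ∀ z ∈ W, D.h.inner z = D'.h.inner z) (hk : ∀ z ∈ W, D.k z = D'.k z)
    (hvac : ∀ [D'.metric.HasLeviCivita], D'.hamiltonianConstraintFn y = 0 ∧ D'.momentumConstraintFn y = 0) :
    ∀ [D.metric.HasLeviCivita], D.hamiltonianConstraintFn y = 0 ∧ D.momentumConstraintFn y = 0 := by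
  intro _
  haveI : D'.metric.HasLeviCivita := PseudoRiemannianMetric.hasLeviCivita _
  have hh' : ∀ᶠ z in 𝓝 y, D.h.inner z = D'.h.inner z := by
    filter_upwards [hWo.mem_nhds hyW] with z hz using hh z hz
  have hk' : ∀ᶠ z in 𝓝 y, D.k z = D'.k z := by
    filter_upwards [hWo.mem_nhds hyW] with z hz using hk z hz
  exact (InitialDataSet.isVacuumAt_congr hh' hk').2 hvac

/-! ### Patching two data across an annulus -/

/-- **Patching two data on `ℝ³` which agree on an annulus.** If `D₁`, `D₂` have the same sections on
`{a < ‖y‖ < b}`, `a < b`, there is a datum `D` on `ℝ³` whose sections are those of `D₁` on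
`{‖y‖ < b}` and those of `D₂` on `{a < ‖y‖}`; consequently `D` satisfies the vacuum constraints at a
point of `{‖y‖ < b}` (resp. `{a < ‖y‖}`) where `D₁` (resp. `D₂`) does. Corvino 2000, §4 (patching
across a coordinate annulus); Bartnik–Isenberg 2004, §2. [cite: Corvino2000, §4] -/
theorem exists_patch_ball (D₁ D₂ : InitialDataSet (𝓡 3) E3) {a b : ℝ} (hab : a < b)
    (hh : ∀ y : E3, a < ‖y‖ → ‖y‖ < b → D₁.h.inner y = D₂.h.inner y)
    (hk : ∀ y : E3, a < ‖y‖ → ‖y‖ < b → D₁.k y = D₂.k y) :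
    ∃ D : InitialDataSet (𝓡 3) E3,
      (∀ y : E3, ‖y‖ < b → D.h.inner y = D₁.h.inner y ∧ D.k y = D₁.k y) ∧
      (∀ y : E3, a < ‖y‖ → D.h.inner y = D₂.h.inner y ∧ D.k y = D₂.k y) ∧
      (∀ y : E3, ‖y‖ < b →
        (∀ [D₁.metric.HasLeviCivita], D₁.hamiltonianConstraintFn y = 0 ∧ D₁.momentumConstraintFn y = 0) →
        ∀ [D.metric.HasLeviCivita], D.hamiltonianConstraintFn y = 0 ∧ D.momentumConstraintFn y = 0) ∧
      (∀ y : E3, a < ‖y‖ →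
        (∀ [D₂.metric.HasLeviCivita], D₂.hamiltonianConstraintFn y = 0 ∧ D₂.momentumConstraintFn y = 0) →
        ∀ [D.metric.HasLeviCivita], D.hamiltonianConstraintFn y = 0 ∧ D.momentumConstraintFn y = 0) := by
  classical
  -- the patched fields, cut at the middle radius `c = (a + b)/2`
  set c : ℝ := (a + b) / 2 with hc
  have hac : a < c := by rw [hc]; linarith
  have hcb : c < b := by rw [hc]; linarith
  set hF : E3 → E3 →L[ℝ] E3 →L[ℝ] ℝ := fun y ↦ if ‖y‖ < c then D₁.coordH y else D₂.coordH y with hF_def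
  set kF : E3 → E3 →L[ℝ] E3 →L[ℝ] ℝ := fun y ↦ if ‖y‖ < c then D₁.coordK y else D₂.coordK y with kF_def
  -- on the ball the patched fields are those of `D₁`, beyond radius `a` those of `D₂`
  have hin : ∀ y : E3, ‖y‖ < b → hF y = D₁.coordH y ∧ kF y = D₁.coordK y := fun y hy ↦ by
    by_cases hyc : ‖y‖ < c
    · simp only [hF_def, kF_def, if_pos hyc, and_self]
    · have hya : a < ‖y‖ := lt_of_lt_of_le hac (not_lt.1 hyc)
      simp only [hF_def, kF_def, if_neg hyc]
      exact ⟨(hh y hya hy).symm, (hk y hya hy).symm⟩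
  have hout : ∀ y : E3, a < ‖y‖ → hF y = D₂.coordH y ∧ kF y = D₂.coordK y := fun y hy ↦ by
    by_cases hyc : ‖y‖ < c
    · simp only [hF_def, kF_def, if_pos hyc]
      exact ⟨hh y hy (lt_trans hyc hcb), hk y hy (lt_trans hyc hcb)⟩
    · simp only [hF_def, kF_def, if_neg hyc, and_self]
  -- local models: `D₁` restricted to the ball, `D₂` restricted to the exterior region
  have hloc : ∀ y : E3, ∃ (U : Opens E3) (DU : InitialDataSet 𝓘(ℝ, E3) U) (W : Set E3),
      IsOpen W ∧ y ∈ W ∧ W ⊆ U ∧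
      ∀ z (hz : z ∈ U), z ∈ W →
        (∀ v w, hF z v w = DU.h.inner ⟨z, hz⟩ v w) ∧ (∀ v w, kF z v w = DU.k ⟨z, hz⟩ v w) := by
    intro y
    by_cases hy : ‖y‖ < b
    · refine ⟨⊤, D₁.comap (Subtype.val : (⊤ : Opens E3) → E3)
        (InitialDataSet.contMDiff_subtypeVal_succ ⊤) (InitialDataSet.injective_mfderiv_subtypeVal ⊤),
        {z : E3 | ‖z‖ < b}, isOpen_lt continuous_norm continuous_const, hy, fun _ _ ↦ trivial,
        fun z hz hzW ↦ ⟨fun v w ↦ ?_, fun v w ↦ ?_⟩⟩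
      · rw [comap_subtypeVal_h_inner, (hin z hzW).1]; rfl
      · rw [comap_subtypeVal_k, (hin z hzW).2]; rfl
    · have hya : a < ‖y‖ := lt_of_lt_of_le hab (not_lt.1 hy)
      refine ⟨⊤, D₂.comap (Subtype.val : (⊤ : Opens E3) → E3)
        (InitialDataSet.contMDiff_subtypeVal_succ ⊤) (InitialDataSet.injective_mfderiv_subtypeVal ⊤),
        {z : E3 | a < ‖z‖}, isOpen_lt continuous_const continuous_norm, hya, fun _ _ ↦ trivial,
        fun z hz hzW ↦ ⟨fun v w ↦ ?_, fun v w ↦ ?_⟩⟩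
      · rw [comap_subtypeVal_h_inner, (hout z hzW).1]; rfl
      · rw [comap_subtypeVal_k, (hout z hzW).2]; rfl
  obtain ⟨D, hDh, hDk⟩ := exists_initialDataSet_of_pieces hloc
  have hDin : ∀ y : E3, ‖y‖ < b → D.h.inner y = D₁.h.inner y ∧ D.k y = D₁.k y := fun y hy ↦
    ⟨(congrFun hDh y).trans (hin y hy).1, (congrFun hDk y).trans (hin y hy).2⟩
  have hDout : ∀ y : E3, a < ‖y‖ → D.h.inner y = D₂.h.inner y ∧ D.k y = D₂.k y := fun y hy ↦
    ⟨(congrFun hDh y).trans (hout y hy).1, (congrFun hDk y).trans (hout y hy).2⟩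
  refine ⟨D, hDin, hDout, fun y hy hvac ↦ ?_, fun y hy hvac ↦ ?_⟩
  · exact vacAt_of_eqOn D D₁ (isOpen_lt continuous_norm continuous_const) hy
      (fun z hz ↦ (hDin z hz).1) (fun z hz ↦ (hDin z hz).2) hvac
  · exact vacAt_of_eqOn D D₂ (isOpen_lt continuous_const continuous_norm) hy
      (fun z hz ↦ (hDout z hz).1) (fun z hz ↦ (hDout z hz).2) hvac

/-- **The vacuum constraints at a point are shared by data on `ℝ³` with the same sections near the
point** (`vacAt_of_eqOn` in both directions). Bartnik–Isenberg 2004, §2. [cite: BartnikIsenberg2004, §2] -/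
theorem vacAt_iff_of_eqOn (D D' : InitialDataSet (𝓡 3) E3) {W : Set E3} (hWo : IsOpen W) {y : E3}
    (hyW : y ∈ W) (hh : ∀ z ∈ W, D.h.inner z = D'.h.inner z) (hk : ∀ z ∈ W, D.k z = D'.k z) :
    (∀ [D.metric.HasLeviCivita], D.hamiltonianConstraintFn y = 0 ∧ D.momentumConstraintFn y = 0) ↔
      ∀ [D'.metric.HasLeviCivita], D'.hamiltonianConstraintFn y = 0 ∧ D'.momentumConstraintFn y = 0 :=
  ⟨fun h ↦ vacAt_of_eqOn D' D hWo hyW (fun z hz ↦ (hh z hz).symm) (fun z hz ↦ (hk z hz).symm) h,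
    fun h ↦ vacAt_of_eqOn D D' hWo hyW hh hk h⟩

end Summit.FinalStateConjecture.FinalStateConjecture.Theorems.SwallowTheDatum.UniversalWitnessFamily

end
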